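import Literature.AlgebraicGeometry.Resolution.ResolutionOfSingularities
import Literature.AlgebraicGeometry.Resolution.RegularLocalRingsProofs
import Mathlib.AlgebraicGeometry.AffineScheme
import Mathlib.RingTheory.DualNumber
import Mathlib.Algebra.CharP.Defs
import Mathlib.Algebra.Field.ZMod
import HarnessLib

/-!
# Non-reduced schemes have no resolution: `IsReduced` is necessary in `ResolutionInChar`

Topic: `Literature/AlgebraicGeometry/Resolution`. A formal justification of the design choice
"reduced" in the summit statement (`ResolutionOfSingularities.lean`, §Design choices: "reduced
(so several components are allowed, non-reduced structure is not)"), recorded as negative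
knowledge for the crux `PatchingRel` (stmt-ResolutionOfSingularities-0642, standing disprover,
§6 of `Cruxes/patching_rel/Disproof.lean`): with the weak birationality of `IsBirational`
(isomorphism over a dense open with dense preimage, Stacks 01RN) a scheme `X` admitting a
resolution `π : X' → X` (`Scheme.HasResolution`) is regular — in particular reduced — at some
point of every dense open, so a one-point non-reduced scheme has none.

* `not_hasResolution_spec_dualNumber` — `Spec k[ε]` has no resolution: a dense open of the
  one-point space is everything, `π` restricts to an isomorphism onto it, so the stalk `k[ε]`
  would be a regular local ring, hence a domain (Matsumura, Thm. 14.3, proved in the tree as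
  `isDomain_of_isRegularLocalRing`), contradicting `ε ≠ 0 = ε²`.
* `not_resolutionInChar_without_isReduced` — hence `ResolutionInChar p` with the hypothesis
  `IsReduced X` dropped is false for every prime `p` (witness `Spec 𝔽_p[ε] → Spec 𝔽_p`, affine
  hence separated and quasi-compact, of finite type).

## Sources

* H. Matsumura, *Commutative Ring Theory*, CUP 1986, Thm. 14.3 (a regular local ring is a
  domain). [Matsumura1987]
* The Stacks Project, Tag 01RN (birational morphisms), Tag 02IS (regular schemes).
-/

noncomputable section

open CategoryTheory AlgebraicGeometry

namespace Literature.AlgebraicGeometry.Resolution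

/-- In the dual numbers `k[ε]` over a field, an element killing `ε` lies in every prime ideal
(it is a multiple of `ε`, and `ε` is nilpotent). [folklore] -/
theorem DualNumber.mem_of_mul_eps_eq_zero {k : Type*} [Field k] (P : Ideal (DualNumber k))
    [P.IsPrime] {s : DualNumber k} (hs : s * DualNumber.eps = 0) : s ∈ P := by
  have hε : (DualNumber.eps : DualNumber k) ∈ P := by
    have h2 : (DualNumber.eps : DualNumber k) ^ 2 ∈ P := by
      rw [pow_two, DualNumber.eps_mul_eps]; exact P.zero_mem
    exact ‹P.IsPrime›.mem_of_pow_mem 2 h2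
  have hfst : TrivSqZeroExt.fst s = 0 := by
    have := congrArg TrivSqZeroExt.snd hs
    simpa [DualNumber.snd_mul] using this
  have hs' : s = TrivSqZeroExt.inl (TrivSqZeroExt.snd s) * DualNumber.eps := by
    refine TrivSqZeroExt.ext ?_ ?_
    · simp [hfst]
    · simp
  rw [hs']
  exact P.mul_mem_left _ hε

universe u

/-- **`Spec k[ε]` has no resolution of singularities** in the sense of `Scheme.HasResolution`
(proper, birational over a dense open with dense preimage, regular source): the stalk at a point
of the dense open would be a regular local ring, hence a domain (Matsumura, Thm. 14.3), but `ε/1`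
is a non-zero nilpotent of every localisation of `k[ε]`. [cite: Matsumura1987, Thm. 14.3] -/
theorem not_hasResolution_spec_dualNumber (k : Type u) [Field k] :
    ¬ Scheme.HasResolution (Spec (.of (DualNumber k))) := by
  rintro ⟨X', π, hπ⟩
  obtain ⟨U, hUd, -, hUiso⟩ := hπ.isBirational
  haveI := hUiso
  obtain ⟨x, hx⟩ := hUd.nonempty
  -- the stalk of `Spec k[ε]` at `x` is regular: transport along `π⁻¹U ≅ U` and open immersions
  have hreg : IsRegularLocalRing ((Spec (.of (DualNumber k))).presheaf.stalk x) := by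
    let u : (U : Scheme.{u}) := ⟨x, hx⟩
    let e := asIso (π ∣_ U)
    let v := e.inv.base u
    have h1 : IsRegularLocalRing (X'.presheaf.stalk ((π ⁻¹ᵁ U).ι.base v)) := hπ.isRegular _
    have h2 : IsRegularLocalRing ((↑(π ⁻¹ᵁ U) : Scheme.{u}).presheaf.stalk v) :=
      IsRegularLocalRing.of_ringEquiv (asIso ((π ⁻¹ᵁ U).ι.stalkMap v)).commRingCatIsoToRingEquiv
    have h3 : IsRegularLocalRing ((U : Scheme.{u}).presheaf.stalk u) :=
      IsRegularLocalRing.of_ringEquiv (asIso (e.inv.stalkMap u)).commRingCatIsoToRingEquiv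
    exact IsRegularLocalRing.of_ringEquiv (asIso (U.ι.stalkMap u)).commRingCatIsoToRingEquiv.symm
  haveI : IsRegularLocalRing (Localization.AtPrime x.asIdeal) :=
    IsRegularLocalRing.of_ringEquiv (Spec.stalkIso (.of (DualNumber k)) x).commRingCatIsoToRingEquiv
  haveI : IsDomain (Localization.AtPrime x.asIdeal) :=
    isDomain_of_isRegularLocalRing (Localization.AtPrime x.asIdeal)
  -- `ε/1` is nilpotent, hence zero, hence killed by some `s ∉ x`; but such `s` lies in `x`
  have hε : algebraMap (DualNumber k) (Localization.AtPrime x.asIdeal) DualNumber.eps = 0 := by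
    have h2 : (algebraMap (DualNumber k) (Localization.AtPrime x.asIdeal) DualNumber.eps) ^ 2 = 0 := by
      rw [← map_pow, pow_two, DualNumber.eps_mul_eps, map_zero]
    exact (pow_eq_zero_iff two_ne_zero).mp h2
  obtain ⟨⟨s, hs⟩, hsε⟩ :=
    (IsLocalization.map_eq_zero_iff x.asIdeal.primeCompl (Localization.AtPrime x.asIdeal) _).mp hε
  exact (Ideal.mem_primeCompl_iff.mp hs) (DualNumber.mem_of_mul_eps_eq_zero x.asIdeal hsε)

/-- **`ResolutionInChar p` without `IsReduced` is false** for every prime `p`: the statement of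
`ResolutionInChar` with the reducedness hypothesis dropped fails at `Spec 𝔽_p[ε] → Spec 𝔽_p`
(affine, hence separated and quasi-compact; of finite type). Negative knowledge for crux
stmt-ResolutionOfSingularities-0642 (`PatchingRel`): the consequent's `IsReduced` is
load-bearing. [folklore] -/
theorem not_resolutionInChar_without_isReduced (p : ℕ) [Fact p.Prime] :
    ¬ ∀ (k : Type) [Field k] [CharP k p] (X : Scheme.{0}) (f : X ⟶ Spec (.of k)),
      IsSeparated f → LocallyOfFiniteType f → QuasiCompact f → Scheme.HasResolution X := by
  intro h
  haveI : Module.Finite (ZMod p) (DualNumber (ZMod p)) :=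
    inferInstanceAs (Module.Finite (ZMod p) (ZMod p × ZMod p))
  let f : Spec (.of (DualNumber (ZMod p))) ⟶ Spec (.of (ZMod p)) :=
    Spec.map (CommRingCat.ofHom (algebraMap (ZMod p) (DualNumber (ZMod p))))
  haveI : LocallyOfFiniteType f :=
    (HasRingHomProperty.Spec_iff (P := @LocallyOfFiniteType)).mpr
      (RingHom.finiteType_algebraMap.mpr inferInstance)
  exact not_hasResolution_spec_dualNumber (ZMod p)
    (h (ZMod p) (Spec (.of (DualNumber (ZMod p)))) f inferInstance inferInstance inferInstance)

end Literature.AlgebraicGeometry.Resolution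

end
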